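import Mathlib.Analysis.SpecialFunctions.Pow.Real
import Mathlib.Algebra.BigOperators.Intervals
import Mathlib.Tactic

/-!
# Route `UnitScaleTilt` — crux K1bR-pr `FluctuationComparisonRegPr` (stmt-QuantumFields-19201), stub `stub_oneStepSmallLift`
# (W7 line), piece (L1) FOR EVERY ODD BLOCK SIZE: the ONE-DIMENSIONAL «DUAL WHITNEY» PROFILES
# (support file `--supports stmt-QuantumFields-19201`; cell `ym3-torus`, seat `ym3-torus-p1` gen 10; memo HOME/UV3-NODE.md §19)

The abelian cochain model of Bałaban's (0.4) block average at block size `L = 2h+1` (IR-NODE §13.1, CertL3/CertL5 of seat p2 g8)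
factorises direction by direction: the LINE average of a fine 1-cochain in its own direction is `(Sw)(y) = L⁻³ Σ_{r ∈ [-h,h]³}
Σ_{t<L} w(Ly + r + t e_μ)`, i.e. per axis the «box × line» functional `g ↦ Σ_{r=-h}^{h} Σ_{t=0}^{L-1} g(Ln + r + t)`
(longitudinal) resp. `g ↦ Σ_{r=-h}^{h} g(Ln + r)` (transverse).  A tensor-product interpolant
`(R₁v)(z;μ) = L⁻¹ Σ_y Φ₁(z_μ − Ly_μ) Φ₀(z_ν − Ly_ν) Φ₀(z_λ − Ly_λ) v(y;μ)` commutes with the coboundary iff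
`Φ₀(s) − Φ₀(s+1) = (Φ₁(s) − Φ₁(s+L))/L` (cubical Whitney: `Φ₁ = 1_[0,L)`, `Φ₀ =` tent), and is an EXACT right inverse of
the line average («dual») iff `Σ_{r,t} Φ₁(Ln + r + t) = L²·[n = 0]`.  This file records ONE explicit dual, d-commuting
pair of profiles, for every `h ≥ 1`:

* `phi1 = u` on `[0,2h]` except `C` at `s = h`, `−w` on `[−h,−1] ∪ [2h+1,3h]`, `0` elsewhere, with
  `u = L(3h+1)/(L²+1)`, `w = L(h+1)/(L²+1)`, `C = u + w = 2L²/(L²+1)`;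
* `phi0` = its window mean `L⁻¹ Σ_{t<L} phi1(s+t)`, given in CLOSED FORM (piecewise linear, support `[−3h,3h]`);

and proves here the piecewise evaluations, the STEP identity `phi0_step` (d-commutation) and the WINDOW identity `phi0_window`;
the sequel `…DualWhitney1DDual` proves TRANSVERSE/LONGITUDINAL DUALITY (`Σ_{i<L} phi0(Ln − h + i) = L·[n=0]`,
`Σ_{i<L}Σ_{t<L} phi1(Ln − h + i + t) = L²·[n=0]`), the PARTITION OF UNITY, the POLYPHASE ℓ¹ BOUNDS (`Σ_n |Φ(s+Ln)| ≤ C`) and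
the gain arithmetic `C³/L² = 8L⁴/(L²+1)³ < L^{-1/2}` (`L ≥ 5`); the three-dimensional operators (`S∘R₁ = 1`, `d₁R₁ = R₂d₁`,
`‖R₂‖ ≤ C³/L²`) are `…DualWhitney3D`.  Elementary real arithmetic; nothing of Bałaban's is asserted.
-/

noncomputable section

namespace Summit.QuantumFields.YangMills.Theorems.DualWhitney

open Finset

variable (h : ℕ)

/-! ## §1 Constants -/

/-- The block size `L = 2h + 1`. -/
def bL : ℕ := 2 * h + 1

/-- `(L : ℝ) = 2h + 1`. -/
theorem bL_cast : (bL h : ℝ) = 2 * h + 1 := by unfold bL; push_cast; ring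

/-- `0 < L` (real). -/
theorem bL_pos : (0 : ℝ) < (bL h : ℝ) := by rw [bL_cast]; positivity

/-- `L² + 1 > 0` (real). -/
theorem bL_sq_add_one_pos : (0 : ℝ) < (bL h : ℝ) ^ 2 + 1 := by positivity

/-- The plateau value `u = L(3h+1)/(L²+1)` of the longitudinal profile. -/
def cu : ℝ := (bL h : ℝ) * (3 * h + 1) / ((bL h : ℝ) ^ 2 + 1)

/-- The wing value `w = L(h+1)/(L²+1)` of the longitudinal profile (it enters with a minus sign). -/
def cw : ℝ := (bL h : ℝ) * (h + 1) / ((bL h : ℝ) ^ 2 + 1)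

/-- The central value and polyphase constant `C = 2L²/(L²+1)`. -/
def cC : ℝ := 2 * (bL h : ℝ) ^ 2 / ((bL h : ℝ) ^ 2 + 1)

/-- `u + w = C`. -/
theorem cu_add_cw : cu h + cw h = cC h := by
  unfold cu cw cC; rw [bL_cast]; field_simp; ring

/-- `0 < w`. -/
theorem cw_pos : 0 < cw h := by unfold cw; have := bL_pos h; positivity

/-- `0 < u`. -/
theorem cu_pos : 0 < cu h := by unfold cu; have := bL_pos h; positivity

/-- `0 < C`. -/
theorem cC_pos : 0 < cC h := by unfold cC; have := bL_pos h; positivity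

/-- `w ≤ u`. -/
theorem cw_le_cu : cw h ≤ cu h := by
  unfold cu cw
  have hL := bL_pos h
  have h0 : (0 : ℝ) ≤ h := Nat.cast_nonneg h
  exact div_le_div_of_nonneg_right (mul_le_mul_of_nonneg_left (by linarith) hL.le) (bL_sq_add_one_pos h).le

/-- The balance identity `u(h+1) = w(3h+1)` behind the off-centre dualities. -/
theorem cu_mul_eq_cw_mul : cu h * ((h : ℝ) + 1) = cw h * (3 * h + 1) := by
  unfold cu cw; ring

/-- `C < 2`. -/
theorem cC_lt_two : cC h < 2 := by
  unfold cC
  rw [div_lt_iff₀ (bL_sq_add_one_pos h)]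
  linarith

/-! ## §2 The profiles -/

/-- THE LONGITUDINAL PROFILE `Φ₁` (relative coordinate `s = z − Ly` along the bond's own direction):
`C` at `s = h`, `u` on `[0,2h] \ {h}`, `−w` on `[−h,−1] ∪ [2h+1,3h]`, `0` elsewhere. -/
def phi1 (s : ℤ) : ℝ :=
  if s = h then cC h
  else if 0 ≤ s ∧ s ≤ 2 * h then cu h
  else if (-(h : ℤ) ≤ s ∧ s ≤ -1) ∨ (2 * (h : ℤ) + 1 ≤ s ∧ s ≤ 3 * h) then -cw h
  else 0

/-- THE TRANSVERSE PROFILE `Φ₀` in closed form (it is the window mean `L⁻¹Σ_{t<L} Φ₁(s+t)`, `phi0_window`): piecewise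
linear, even, supported in `[−3h, 3h]`. -/
def phi0 (s : ℤ) : ℝ :=
  if -(h : ℤ) ≤ s ∧ s ≤ 0 then (2 * h * cu h + cC h + cC h * s) / bL h
  else if 0 < s ∧ s ≤ h then (2 * h * cu h + cC h - cC h * s) / bL h
  else if (h : ℤ) < s ∧ s ≤ 2 * h then (cu h * (2 * h + 1 - s) - cw h * h) / bL h
  else if 2 * (h : ℤ) < s ∧ s ≤ 3 * h then -(cw h * (3 * h + 1 - s)) / bL h
  else if -(2 * (h : ℤ)) ≤ s ∧ s < -h then (cu h * (2 * h + 1 + s) - cw h * h) / bL h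
  else if -(3 * (h : ℤ)) ≤ s ∧ s < -(2 * h) then -(cw h * (3 * h + 1 + s)) / bL h
  else 0

section Eval
variable {h} {s : ℤ}

/-- `Φ₁(h) = C`. -/
theorem phi1_ctr (hs : s = h) : phi1 h s = cC h := by unfold phi1; rw [if_pos hs]

/-- `Φ₁ = u` on `[0,2h] \ {h}`. -/
theorem phi1_plat (h1 : 0 ≤ s) (h2 : s ≤ 2 * h) (h3 : s ≠ h) : phi1 h s = cu h := by
  unfold phi1; split_ifs <;> first | rfl | (exfalso; omega)

/-- `Φ₁ = −w` on the left wing `[−h,−1]`. -/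
theorem phi1_wingL (h1 : -(h : ℤ) ≤ s) (h2 : s ≤ -1) : phi1 h s = -cw h := by
  unfold phi1; split_ifs <;> first | rfl | (exfalso; omega)

/-- `Φ₁ = −w` on the right wing `[2h+1,3h]`. -/
theorem phi1_wingR (h1 : 2 * (h : ℤ) + 1 ≤ s) (h2 : s ≤ 3 * h) : phi1 h s = -cw h := by
  unfold phi1; split_ifs <;> first | rfl | (exfalso; omega)

/-- `Φ₁ = 0` left of `−h`. -/
theorem phi1_zeroL (h1 : s < -(h : ℤ)) : phi1 h s = 0 := by
  unfold phi1; split_ifs <;> first | rfl | (exfalso; omega)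

/-- `Φ₁ = 0` right of `3h`. -/
theorem phi1_zeroR (h1 : 3 * (h : ℤ) < s) : phi1 h s = 0 := by
  unfold phi1; split_ifs <;> first | rfl | (exfalso; omega)

/-- `Φ₀` on `[−h,0]`. -/
theorem phi0_A (h1 : -(h : ℤ) ≤ s) (h2 : s ≤ 0) : phi0 h s = (2 * h * cu h + cC h + cC h * s) / bL h := by
  unfold phi0; rw [if_pos ⟨h1, h2⟩]

/-- `Φ₀` on `(0,h]`. -/
theorem phi0_B (h1 : 0 < s) (h2 : s ≤ h) : phi0 h s = (2 * h * cu h + cC h - cC h * s) / bL h := by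
  unfold phi0; split_ifs <;> first | rfl | (exfalso; omega)

/-- `Φ₀` on `(h,2h]`. -/
theorem phi0_Cp (h1 : (h : ℤ) < s) (h2 : s ≤ 2 * h) : phi0 h s = (cu h * (2 * h + 1 - s) - cw h * h) / bL h := by
  unfold phi0; split_ifs <;> first | rfl | (exfalso; omega)

/-- `Φ₀` on `(2h,3h]`. -/
theorem phi0_Dp (h1 : 2 * (h : ℤ) < s) (h2 : s ≤ 3 * h) : phi0 h s = -(cw h * (3 * h + 1 - s)) / bL h := by
  unfold phi0; split_ifs <;> first | rfl | (exfalso; omega)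

/-- `Φ₀` on `[−2h,−h)`. -/
theorem phi0_Cm (h1 : -(2 * (h : ℤ)) ≤ s) (h2 : s < -h) : phi0 h s = (cu h * (2 * h + 1 + s) - cw h * h) / bL h := by
  unfold phi0; split_ifs <;> first | rfl | (exfalso; omega)

/-- `Φ₀` on `[−3h,−2h)`. -/
theorem phi0_Dm (h1 : -(3 * (h : ℤ)) ≤ s) (h2 : s < -(2 * h)) : phi0 h s = -(cw h * (3 * h + 1 + s)) / bL h := by
  unfold phi0; split_ifs <;> first | rfl | (exfalso; omega)

/-- `Φ₀ = 0` left of `−3h`. -/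
theorem phi0_zeroL (h1 : s < -(3 * (h : ℤ))) : phi0 h s = 0 := by
  unfold phi0; split_ifs <;> first | rfl | (exfalso; omega)

/-- `Φ₀ = 0` right of `3h`. -/
theorem phi0_zeroR (h1 : 3 * (h : ℤ) < s) : phi0 h s = 0 := by
  unfold phi0; split_ifs <;> first | rfl | (exfalso; omega)

end Eval

/-! ## §3 The step identity (d-commutation) and the window identity -/

/-- `(L : ℤ) = 2h + 1`. -/
theorem bL_int : ((bL h : ℕ) : ℤ) = 2 * (h : ℤ) + 1 := by unfold bL; push_cast; ring

/-- **STEP IDENTITY** `L·(Φ₀(s) − Φ₀(s+1)) = Φ₁(s) − Φ₁(s+L)` for every `s` — the one-dimensional form of «Whitney commutes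
with the coboundary» for the pair `(Φ₁, Φ₀)` (`h ≥ 1`). -/
theorem phi0_step (hh : 1 ≤ h) (s : ℤ) : (bL h : ℝ) * (phi0 h s - phi0 h (s + 1)) = phi1 h s - phi1 h (s + bL h) := by
  have hL := bL_pos h
  have hLne : (bL h : ℝ) ≠ 0 := hL.ne'
  have hLr := bL_cast h
  rw [bL_int]
  have key : s ≤ -3*h-2 ∨ s = -3*h-1 ∨ (-3*(h:ℤ) ≤ s ∧ s ≤ -2*h-2) ∨ s = -2*h-1 ∨ (-2*(h:ℤ) ≤ s ∧ s ≤ -h-2) ∨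
      s = -h-1 ∨ (-(h:ℤ) ≤ s ∧ s ≤ -1) ∨ s = 0 ∨ (1 ≤ s ∧ s ≤ h-1) ∨ s = h ∨ ((h:ℤ)+1 ≤ s ∧ s ≤ 2*h-1) ∨
      s = 2*h ∨ (2*(h:ℤ)+1 ≤ s ∧ s ≤ 3*h-1) ∨ s = 3*h ∨ 3*(h:ℤ)+1 ≤ s := by omega
  rcases key with h1 | h1 | ⟨h1, h2⟩ | h1 | ⟨h1, h2⟩ | h1 | ⟨h1, h2⟩ | h1 | ⟨h1, h2⟩ | h1 | ⟨h1, h2⟩ | h1 | ⟨h1, h2⟩ |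
      h1 | h1
  · -- R1: everything vanishes
    rw [phi0_zeroL (by omega), phi0_zeroL (by omega), phi1_zeroL (by omega), phi1_zeroL (by omega)]; ring
  · -- R2: s = -3h-1
    rw [phi0_zeroL (by omega), phi0_Dm (by omega) (by omega), phi1_zeroL (by omega), phi1_wingL (by omega) (by omega)]
    subst h1; push_cast; field_simp; ring
  · -- R3
    rw [phi0_Dm (by omega) (by omega), phi0_Dm (by omega) (by omega), phi1_zeroL (by omega),
      phi1_wingL (by omega) (by omega)]
    push_cast; field_simp; ring
  · -- R4: s = -2h-1
    rw [phi0_Dm (by omega) (by omega), phi0_Cm (by omega) (by omega), phi1_zeroL (by omega),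
      phi1_plat (by omega) (by omega) (by omega)]
    subst h1; push_cast; field_simp; ring
  · -- R5
    rw [phi0_Cm (by omega) (by omega), phi0_Cm (by omega) (by omega), phi1_zeroL (by omega),
      phi1_plat (by omega) (by omega) (by omega)]
    push_cast; field_simp; ring
  · -- R6: s = -h-1
    rw [phi0_Cm (by omega) (by omega), phi0_A (by omega) (by omega), phi1_zeroL (by omega), phi1_ctr (by omega),
      ← cu_add_cw]
    subst h1; push_cast; field_simp; ring
  · -- R7
    rw [phi0_A (by omega) (by omega), phi0_A (by omega) (by omega), phi1_wingL (by omega) (by omega),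
      phi1_plat (by omega) (by omega) (by omega), ← cu_add_cw]
    push_cast; field_simp; ring
  · -- R8: s = 0
    rw [phi0_A (by omega) (by omega), phi0_B (by omega) (by omega), phi1_plat (by omega) (by omega) (by omega),
      phi1_wingR (by omega) (by omega), ← cu_add_cw]
    subst h1; push_cast; field_simp; ring
  · -- R9
    rw [phi0_B (by omega) (by omega), phi0_B (by omega) (by omega), phi1_plat (by omega) (by omega) (by omega),
      phi1_wingR (by omega) (by omega), ← cu_add_cw]
    push_cast; field_simp; ring
  · -- R10: s = h
    rw [phi0_B (by omega) (by omega), phi0_Cp (by omega) (by omega), phi1_ctr h1, phi1_zeroR (by omega), ← cu_add_cw]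
    subst h1; push_cast; field_simp; ring
  · -- R11
    rw [phi0_Cp (by omega) (by omega), phi0_Cp (by omega) (by omega), phi1_plat (by omega) (by omega) (by omega),
      phi1_zeroR (by omega)]
    push_cast; field_simp; ring
  · -- R12: s = 2h
    rw [phi0_Cp (by omega) (by omega), phi0_Dp (by omega) (by omega), phi1_plat (by omega) (by omega) (by omega),
      phi1_zeroR (by omega)]
    subst h1; push_cast; field_simp; ring
  · -- R13
    rw [phi0_Dp (by omega) (by omega), phi0_Dp (by omega) (by omega), phi1_wingR (by omega) (by omega),
      phi1_zeroR (by omega)]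
    push_cast; field_simp; ring
  · -- R14: s = 3h
    rw [phi0_Dp (by omega) (by omega), phi0_zeroR (by omega), phi1_wingR (by omega) (by omega), phi1_zeroR (by omega)]
    subst h1; push_cast; field_simp; ring
  · -- R15
    rw [phi0_zeroR (by omega), phi0_zeroR (by omega), phi1_zeroR (by omega), phi1_zeroR (by omega)]; ring

/-- **WINDOW IDENTITY** `L·Φ₀(s) = Σ_{t<L} Φ₁(s+t)`: the closed form `phi0` IS the window mean of `phi1` (`h ≥ 1`).  Proof: both
sides have the same discrete derivative by `phi0_step`, and both vanish far to the left. -/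
theorem phi0_window (hh : 1 ≤ h) (s : ℤ) : (bL h : ℝ) * phi0 h s = ∑ t ∈ range (bL h), phi1 h (s + t) := by
  set D : ℤ → ℝ := fun s => (∑ t ∈ range (bL h), phi1 h (s + t)) - (bL h : ℝ) * phi0 h s with hD
  have hstep : ∀ s, D (s + 1) = D s := by
    intro s
    simp only [hD]
    have h1 : ∑ t ∈ range (bL h), phi1 h (s + 1 + t)
        = (∑ t ∈ range (bL h), phi1 h (s + t)) - phi1 h s + phi1 h (s + bL h) := by
      have e1 : ∑ t ∈ range (bL h + 1), phi1 h (s + t) = (∑ t ∈ range (bL h), phi1 h (s + t)) + phi1 h (s + bL h) :=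
        sum_range_succ _ _
      have e2 : ∑ t ∈ range (bL h + 1), phi1 h (s + t)
          = (∑ t ∈ range (bL h), phi1 h (s + (t + 1 : ℕ))) + phi1 h (s + (0 : ℕ)) :=
        sum_range_succ' _ _
      have e3 : ∑ t ∈ range (bL h), phi1 h (s + (t + 1 : ℕ)) = ∑ t ∈ range (bL h), phi1 h (s + 1 + t) := by
        refine sum_congr rfl fun t _ => ?_
        congr 1; push_cast; ring
      rw [e3] at e2
      simp only [Nat.cast_zero, add_zero] at e2
      linarith
    have h2 := phi0_step h hh s
    rw [h1]; linarith
  have hconst : ∀ s, D s = D 0 := by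
    intro s
    induction s using Int.induction_on with
    | zero => rfl
    | succ i ih => rw [hstep, ih]
    | pred i ih =>
      have := hstep (-(i:ℤ) - 1)
      rw [show -(i:ℤ) - 1 + 1 = -i by ring] at this
      rw [← this, ih]
  have hfar : D (-6 * h - 2) = 0 := by
    simp only [hD]
    rw [phi0_zeroL (by omega), mul_zero, sub_zero]
    refine sum_eq_zero fun t ht => ?_
    have ht' : (t : ℤ) < bL h := by exact_mod_cast mem_range.mp ht
    rw [bL_int] at ht'
    exact phi1_zeroL (by omega)
  have : D s = 0 := by rw [hconst s, ← hconst (-6 * h - 2), hfar]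
  simp only [hD] at this
  linarith

/-- An affine sum: `Σ_{i<n} (a + b·i) = n·a + b·n(n−1)/2`. -/
theorem sum_range_affine (a b : ℝ) : ∀ n : ℕ, ∑ i ∈ range n, (a + b * (i : ℝ)) = n * a + b * (n * ((n : ℝ) - 1) / 2)
  | 0 => by simp
  | n + 1 => by rw [sum_range_succ, sum_range_affine a b n]; push_cast; ring

section Eval2
variable {h} {s : ℤ}

/-- `Φ₀` on `[0,h]` (the two central formulas agree at `s = 0`). -/
theorem phi0_B0 (h1 : 0 ≤ s) (h2 : s ≤ h) : phi0 h s = (2 * h * cu h + cC h - cC h * s) / bL h := by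
  rcases h1.eq_or_lt with h0 | h0
  · rw [phi0_A (by omega) (by omega), ← h0]; simp
  · exact phi0_B h0 h2

/-- `Φ₀` on `(2h, 3h+1]` (the formula vanishes at `3h+1`). -/
theorem phi0_Dp1 (h1 : 2 * (h : ℤ) < s) (h2 : s ≤ 3 * h + 1) : phi0 h s = -(cw h * (3 * h + 1 - s)) / bL h := by
  rcases (show s ≤ 3 * h ∨ s = 3 * h + 1 by omega) with h3 | h3
  · exact phi0_Dp h1 h3
  · rw [phi0_zeroR (by omega), h3]; push_cast; ring

/-- `Φ₀` on `[−3h−1, −2h)` (the formula vanishes at `−3h−1`). -/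
theorem phi0_Dm1 (h1 : -(3 * (h : ℤ)) - 1 ≤ s) (h2 : s < -(2 * h)) : phi0 h s = -(cw h * (3 * h + 1 + s)) / bL h := by
  rcases (show -(3 * (h:ℤ)) ≤ s ∨ s = -(3 * h) - 1 by omega) with h3 | h3
  · exact phi0_Dm h3 h2
  · rw [phi0_zeroL (by omega), h3]; push_cast; ring

end Eval2

end Summit.QuantumFields.YangMills.Theorems.DualWhitney
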